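import Summits.QuantumFields.YangMills.Theorems.BalabanUVNodesN12MinimiserFamilyOfClassThresholdUniform
import HarnessLib

/-!
# BalabanUVNodes ∕ N12 — KNIT LINK #2, εreg-UNIFORM EDITION OF RECORD: THE w1 LINEAGE’s (J0′) CHART THEOREM AT `𝐁_k(Z)` OVER THE LANE’s U2 `N12MinimiserFamilyOfClassThresholdUniform` — the
# gauge-tolerance threshold `δ₀` announced from (instance, height, forest) data BEFORE the window, the datum tolerance, the extension, the compact parameter set, the bound, the CLASS
# TOLERANCE `εr` and the gauge tolerance `δc`; per base field only (E) · datum regularity · (δ) (resp. (δ) for a residual re-gauging `U₀^σ`) · (T1@q₀)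
# ([Balaban1985Variational] (2)–(4),(7) pp. 277–278, Thm 1 p. 279, Sect. C (44)–(48) p. 285, (81)–(83) p. 290, (181) p. 307, Sect. G pp. 305–307; [Balaban1985RegularSpaces] (1.7), (1.9)
# p. 77; [Balaban1989LargeFieldI] (1.74) p. 192, Prop. 1 p. 194; [Balaban1989LargeFieldII] p. 357, (1.7)–(1.9) p. 358, (1.12)–(1.13) p. 359; [Balaban1988Convergent] (2.2) p. 255,
# (2.10)–(2.13) pp. 256–257; [Balaban1985Averaging] Prop. 2 (52)–(54) p. 26, (122)–(126) p. 36; [Balaban1987RG1] (0.4) p. 253)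

Cell `pub-ymgap` (HUMAN RULINGS D-0062 ∕ D-0149), seat `pub-ymgap-dag-n12-d` g24 (R134 N12 [B15] s2 = by-name knit at the record; census item E1 = the (J0′) row); count-neutral helper of K1⁹
`stmt-QuantumFields-27364` (`--kind proof --supports … --as helper`).  THEOREMS ONLY (0 `def`, 0 `instance`, 0 `sorry`); four compositions BY NAME, nothing modified.  εreg-UNIFORM SIBLING
of `N12MinimiserFamilyAtRecordBjTowerThreshold` (this seat g24, over V4 p722394): THIS FILE is the same composition over the lane's U2 `N12MinimiserFamilyOfClassThresholdUniform.
hMin_atRecord_of_node00Letters_thm1AtBase_central_ofClass_threshold(_residual)_uniform` (dag-n12-c g26, p724662 — the lane's repair of its own LOCATED-δ₀ν: V4 announced `δ₀` after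
`ν : Stage7Numerics`, hence formally after the class tolerance; U2 announces it from `(Kt, k, Z, ν.M₁, ρ″, B, forest)` and quantifies the window `Λ lo hi`, the datum tolerance `δ`, the
extension, the compact parameter set `K`, `𝓐₀`, the class tolerance `εr` (floors `12(d−1)L·εr ≤ ρ″`, `εr ≤ εH`), the class facts and the gauge tolerance `δc ≤ δ₀` AFTER it; the class
reads `regMSCoPOfRecord F 2 {ν with εreg := εr} …`).  DISCHARGED BY NAME here: ONE rooted forest with its axial slice BEFORE the threshold (dag-n12-w3 `exists_forest_slice_Bj`: (F1),
(F2), (TREE), (F3)); the class facts UNDER `∀ εr` at `ν⟨εreg := εr⟩` (dag-n12-w1 g4 `classLetters_closure_regMSCoPOfRecord_Bj`: `reg′ := closure` of `U_k({Ω_j(Z)}, εr)`, closed, the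
constrained averages continuous on it — its inputs `0 < εr` and [4] Prop. 2's smallness `hα3`∕`hα2` at `α₀ = 2L²·εr` join U2's `εr`-floors); `𝔹 := 𝐁_k(Z)`.  Per base field the consumer
supplies EXACTLY: (E) `IsMinimizer` for the class at `εr`; the datum's scale-`k` regularity on `Z`; (δ) — `U₀` bondwise `δc`-flat on the plaquettes meeting a bond sourced in `Ω₁(Z)`
(§1 ∕ §3), or a RESIDUAL gauge `σ` with (δ) for `U₀^σ` (§2 ∕ §4, dag-n12-w3's (σ)_N output shape); (T1@q₀) over the closure of the class at `εr`.  Two shapes each: U2's own (`∀ {K},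
IsCompact K →` inside) and the CLOSED small-field guard (`∀ G eR`, `K :=` the guard itself, `B15Prop1ClosedGuardUniformRadius.isCompact_setOf_plaqLeOn`) — the shape the knit-row
junction `N12MinimiserFamilyKnitRowThresholdUniform` consumes at `G := plaqsInside (pts k (Z ∩ Λᶜ))`.

HONEST FRAMING ∕ LOCATED.  Compositions by name; (E), the datum row, (δ)∕(σ,δ), (T1@q₀), the per-height letters `hsbU`∕`ρ″ > 0`∕`hHB`∕`0 ≤ B` and the `εr`-rows stay DISPLAYED —
(E)∕(T1@q₀) are [15] Thm 1's existence ∕ uniqueness rows (NODE 00 ∕ N07 ∕ b11 currencies), (δ) is a GAUGE letter (dag-n12-c's LOCATED-GEOM v3 for the shape coverage); `δ₀` and `R`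
are EXISTENCE constants per (instance, height), `δ₀` now certified independent of the class ∕ datum ∕ gauge tolerances and of `K` (census U4 at the shape level; print's volume-uniform
(46)∕(83) and `k`-uniformity NOT claimed); nothing of Bałaban's estimates asserted; N12 NOT discharged; K1⁹ NOT closed; counts unmoved; one finite 𝕋⁴ programme at fixed `ε = L^{-K}` —
R4 closes the conditional rung `BalabanLadder.UV` only; no summit statement is proved here and NOT the Yang–Mills mass gap (Clay); nothing continuum ∕ ℝ⁴ ∕ OS.
-/

noncomputable section

namespace Summit.QuantumFields.YangMills.BalabanUVNodes.N12MinimiserFamilyAtRecordBjTowerThresholdUniform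

open scoped BigOperators Matrix.Norms.L2Operator Topology
open Literature.MathematicalPhysics.QuantumFieldTheory.Balaban1983to89
open T4Continuum
open B15DeterminingSets GaugeField
open ExpMeanLog (expMeanLogSU deltaSU)
open T4AdjointCovarianceUnitary (lieSU)
open Node00
open B15SU2ChartHolomorphic (genE)
open B15Prop1AnalyticExtClause (cplxVec)
open B15Prop1ChartCalculusSU2 (E3)
open T4CubeChartGnomonic (SU2)
open B14.Eq213DetSet (Bj maxDomT Bj_of_gt)
open B14.Eq213MaximalDomains (side)
open B14.Eq22Determines (IsBlockUnion)
open B14.Eq216Concrete (feeds)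
open B5Eq118OneStroke (iterBlockOf)
open B15Eq112TorusCover (lift)
open T4AxialGaugeSmallField (boxPlaqs)
open B15Prop1Carrier (plaqsInside)
open Summit.QuantumFields.YangMills.BalabanUVNodes.N12ClassLetterGeometryOfRecord (classLetters_closure_regMSCoPOfRecord_Bj)
open Summit.QuantumFields.YangMills.BalabanUVNodes.N12ForestSlice (exists_forest_slice_Bj)
open Summit.QuantumFields.YangMills.BalabanUVNodes.N12MinimiserFamilyOfClassThresholdUniform (hMin_atRecord_of_node00Letters_thm1AtBase_central_ofClass_threshold_uniform
  hMin_atRecord_of_node00Letters_thm1AtBase_central_ofClass_threshold_residual_uniform)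
open Literature.MathematicalPhysics.QuantumFieldTheory.BalabanImbrieJaffe1984to88.BIJ85Eq453GaugeField (qsstarGIter0)
open B15AveragingHolomorphic (iterMh)
open B15SU2ChartHolomorphic (expMulC logCoordC)
open B15ShellGauge193 (shellGauge)
open B15Extension193 (extend)
open B16Sect1Backgrounds (toMS expMul)
open B15Prop1ChartSU2 (su2Chart)
open Metric (ball)
open B15Prop1ClosedGuardUniformRadius (isCompact_setOf_plaqLeOn)

variable {F : T4Family} {k : ℕ}



/-! ## §1  (J0′) `hMin` at `𝐁_k(Z)`: `∃ δ₀ > 0` FIRST, then ∀ window ∕ datum tolerance ∕ extension ∕ `K` ∕ `𝓐₀` ∕ class tolerance `εr` ∕ gauge tolerance `δc ≤ δ₀`; per base field (E) +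
datum regularity + (δ) + (T1@q₀) — the lineage's output shape over U2 §2 -/

/-- ★★★ **(J0′) `hMin` AT THE RECORD's `𝐁_k(Z)`, εreg-UNIFORM, OVER THE LANE's U2 §2** — instance-level inputs ONLY `hkK hk1 hdiv hfloor hZblk`, the radius letter `hsbU` at `ρ″ > 0` and
the right-inverse letter `hHB` at `(εH, B)`, `0 ≤ B` (the forest is discharged BEFORE the threshold); ANNOUNCED `∃ δ₀ > 0`; THEN for every window `Λ lo hi`, datum tolerance `δ > 0` with
`6(d−1)Lᵏ·δ ≤ ρ″`, extension `ext`, compact `K`, `𝓐₀ > 1`, class tolerance `εr > 0` with `12(d−1)L·εr ≤ ρ″`, `εr ≤ εH`, [4] Prop. 2's smallness `hα3`∕`hα2` at `2L²·εr` (the class facts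
are discharged from these), and gauge tolerance `0 ≤ δc ≤ δ₀`: per base field `V_k ∈ K` (E) the (2.12) minimiser `U₀` for `U_k({Ω_j(Z)}, εr)`, `PlaqSmallOn (plaqsInside (pts k Z)) δ (ext V_k)`,
(δ) `U₀` bondwise `δc`-flat on the plaquettes meeting a bond sourced in `Ω₁(Z)`, (T1@q₀) over the closure of the class ⇒ the (J0′) conclusion verbatim.
[cite: Balaban1985Variational, (2),(7) p.278, Thm 1 p.279, Sect. C (44)–(48) p.285, (81)–(83) p.290, Sect. G pp.305–307; Balaban1985RegularSpaces, (1.7), (1.9) p.77; Balaban1989LargeFieldI, (1.74) p.192, Prop. 1 p.194; Balaban1989LargeFieldII, p.357, (1.7)–(1.9) p.358, (1.12)–(1.13) p.359; Balaban1988Convergent, (2.2) p.255, (2.10)–(2.13) pp.256–257; Balaban1985Averaging, Prop. 2 (52)–(54) p.26, (122)–(126) p.36; Balaban1987RG1, (0.4) p.253] -/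
theorem hMin_atRecord_Bj_of_printLetters_ofClassThresholdUniform (ν : Node00.Stage7Numerics) (Kt : ℕ) (hd3 : 3 ≤ (F.P Kt).d) (Z : Set (Site (F.P Kt) 0))
    (hkK : k + 1 ≤ (F.P Kt).m + (F.P Kt).K) (hk1 : 1 ≤ k) (hdiv : side (F.P Kt).L ν.M₁ k ∣ (F.P Kt).sitesPerDir 0) (hfloor : ((F.P Kt).d + 14) * (F.P Kt).L ≤ ν.M₁) (hZblk : IsBlockUnion k Z)
    -- the per-HEIGHT letters (EXISTENCE constants per (instance, height), inhabited before everything else by dag-n12-w6's `N12HsurjOfClass.exists_hsurjLetters`): the radius letter `hsbU` at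
    -- `ρ″ > 0` and the right-inverse letter `hHB` at `(εH, B)`, `0 ≤ B` — `ν.εreg` is NOT read (the class tolerance `εr` comes after the threshold)
    {ρ'' : ℝ} (hsbU : ∀ W : GaugeField (F.P Kt) 0 SU2, ‖coeField W - 1‖ ≤ ρ'' → SmallBelow (Node00.avOfRecord F 2 Kt) k W) (hρ : 0 < ρ'')
    {εH B : ℝ}
    (hHB : ∀ (Wd : MSField (F.P Kt) SU2) (U₀ : GaugeField (F.P Kt) 0 SU2),
      AgreeOn (Bj ν.M₁ Z k) (avgFamily (avOfRecord F 2 Kt) U₀) Wd →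
      (∀ i' : Fin (constrCard (Bj ν.M₁ Z k) k), ∃ U' : GaugeField (F.P Kt) 0 SU2,
        (∀ b ∈ feeds (((constrEnum (Bj ν.M₁ Z k) k).symm i').1 : ℕ) ((constrEnum (Bj ν.M₁ Z k) k).symm i').2.1, U' b = U₀ b) ∧
          SmallBelow (avOfRecord F 2 Kt) k U') →
      (∀ (j : ℕ), 1 ≤ j → j ≤ k → ∀ y : Site (F.P Kt) j, embIter j y ∈ maxDomT ν.M₁ Z j → ∃ U' : GaugeField (F.P Kt) 0 SU2,
        (∀ c : PBond (F.P Kt) j, (c.src = y ∨ c.tgt = y) → ∀ b₀ : PBond (F.P Kt) 0,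
          (iterBlockOf j b₀.src = c.src ∨ iterBlockOf j b₀.src = c.tgt) → (iterBlockOf j b₀.tgt = c.src ∨ iterBlockOf j b₀.tgt = c.tgt) → U' b₀ = U₀ b₀) ∧
        SmallBelow (avOfRecord F 2 Kt) k U') →
      (∀ (j : ℕ), 1 ≤ j → j ≤ k → ∀ y : Site (F.P Kt) j, embIter j y ∈ maxDomT ν.M₁ Z j →
        PlaqSmallOn (boxPlaqs (fun κ => lift (F.P Kt) (embIter j y) κ - ((((F.P Kt).L ^ j : ℕ) : ℤ) + ((((F.P Kt).L ^ j - 1) / 2 : ℕ) : ℤ)))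
          (fun κ => lift (F.P Kt) (embIter j y) κ + ((((F.P Kt).L ^ j : ℕ) : ℤ) + ((((F.P Kt).L ^ j - 1) / 2 : ℕ) : ℤ))) : Set (Plaq (F.P Kt) 0)) εH U₀) →
      ∃ H : (Fin (constrCard (Bj ν.M₁ Z k) k) → lieSU (Fin 2)) → PBond (F.P Kt) 0 → lieSU (Fin 2),
        (∀ v, fderiv ℝ (msChart F 2 Kt k (Bj ν.M₁ Z k) Wd U₀) 0 (H v) = v) ∧ ∀ v, Real.sqrt (∑ b, ‖H v b‖ ^ 2) ≤ B * ‖v‖) (hB0 : 0 ≤ B) :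
    ∃ δ₀ : ℝ, 0 < δ₀ ∧
    -- THE WINDOW, THE DATUM's REGULARITY TOLERANCE, THE EXTENSION, THE COMPACT PARAMETER SET AND THE BOUND — ALL AFTER THE CONSTANTS
    ∀ (Λ : Set (Site (F.P Kt) k)) (lo hi : Fin (F.P Kt).d → ℤ) {δ : ℝ}, 0 < δ → 6 * ((((F.P Kt).d - 1 : ℕ)) : ℝ) * (F.P Kt).L ^ k * δ ≤ ρ'' →
    ∀ (ext : GaugeField (F.P Kt) k SU2 → GaugeField (F.P Kt) k SU2), (∀ W, ext W = extend Λ (shellGauge W lo hi) W) →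
    ∀ {K : Set (GaugeField (F.P Kt) k SU2)}, IsCompact K → ∀ {𝓐₀ : ℝ}, 1 < 𝓐₀ →
    -- THE CLASS TOLERANCE, ITS FLOORS AND THE CLASS FACTS, AFTER THE THRESHOLD (εreg-uniform edition: `ν⟨εreg := εr⟩`, `M₁` unchanged)
    -- (w1 g4's class letters at the tolerance `εr`: positivity and [4] Prop. 2's smallness at `α₀ = 2L²·εr` — the inputs of `classLetters_closure_regMSCoPOfRecord_Bj`, which discharges U2's
    -- class facts `reg' hreg' hcl hDreg'` at `reg' := closure` of the class `U_k({Ω_j(Z)}, εr)`)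
    ∀ (εr : ℝ), 0 < εr → 12 * ((((F.P Kt).d - 1 : ℕ)) : ℝ) * (F.P Kt).L * εr ≤ ρ'' → εr ≤ εH →
      (143 * (((((F.P Kt).d + 4 : ℕ) : ℝ)) ^ 2 / 4) ^ 2) * (2 * ((F.P Kt).L : ℝ) ^ 2 * εr) ≤ 1 / 3 →
      2 * (2 * ((F.P Kt).L : ℝ) ^ 2 * εr) ≤ 2 * deltaSU (Fin 2) / ((((F.P Kt).d + 4) * (F.P Kt).L : ℕ) : ℝ) ^ 2 →
    ∀ {δc : ℝ}, 0 ≤ δc → δc ≤ δ₀ →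
    (∀ Vk ∈ K, ∃ U₀ : GaugeField (F.P Kt) 0 SU2,
      IsMinimizer (Node00.avOfRecord F 2 Kt) (Node00.regMSCoPOfRecord F 2 {ν with εreg := εr} Kt k (maxDomT ν.M₁ Z)) (Bj ν.M₁ Z k)
        (avgFamily (Node00.avOfRecord F 2 Kt) (qsstarGIter0 k (ext Vk))) U₀ ∧
      -- the DATUM's scale-`k` plaquette regularity on `Z` (the p. 193 extension `Ṽ_k = ext V_k`; the road's `B15ShellGauge193Local.dist1_plaqHol_extend_shellGauge_le`)
      PlaqSmallOn (plaqsInside (pts k Z)) δ (ext Vk) ∧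
      -- (δ) DISPLAYED — THE ONE GAUGE letter (the direct road's (N)-package clause): `U₀` bondwise `δc`-flat on the plaquettes meeting a bond sourced in `Ω₁(Z)`; the tower-flatness row (δ_T) and the multiplier row (M) of p717767 FOLLOW (`B15Prop1TowerFlatOfNearFlat`; dag-n12-w6's `…N12MultiplierLetterOfClass` + the lane's `…N12SliceDatumCurvatureOfClass`)
      (∀ q : Plaq (F.P Kt) 0, ((⟨q.src, q.μ⟩ : PBond (F.P Kt) 0) ∈ {b : PBond (F.P Kt) 0 | b.src ∈ maxDomT ν.M₁ Z 1} ∨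
          (⟨q.src.shift q.μ, q.ν⟩ : PBond (F.P Kt) 0) ∈ {b : PBond (F.P Kt) 0 | b.src ∈ maxDomT ν.M₁ Z 1} ∨
          (⟨q.src.shift q.ν, q.μ⟩ : PBond (F.P Kt) 0) ∈ {b : PBond (F.P Kt) 0 | b.src ∈ maxDomT ν.M₁ Z 1} ∨
          (⟨q.src, q.ν⟩ : PBond (F.P Kt) 0) ∈ {b : PBond (F.P Kt) 0 | b.src ∈ maxDomT ν.M₁ Z 1}) →
        ‖((U₀ ⟨q.src, q.μ⟩ : SU2) : Matrix (Fin 2) (Fin 2) ℂ) - 1‖ ≤ δc ∧ ‖((U₀ ⟨q.src.shift q.μ, q.ν⟩ : SU2) : Matrix (Fin 2) (Fin 2) ℂ) - 1‖ ≤ δc ∧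
          ‖((U₀ ⟨q.src.shift q.ν, q.μ⟩ : SU2) : Matrix (Fin 2) (Fin 2) ℂ) - 1‖ ≤ δc ∧ ‖((U₀ ⟨q.src, q.ν⟩ : SU2) : Matrix (Fin 2) (Fin 2) ℂ) - 1‖ ≤ δc) ∧
      -- (T1@q₀) — the capstone's row verbatim
      (∀ U ∈ closure (Node00.regMSCoPOfRecord F 2 {ν with εreg := εr} Kt k (maxDomT ν.M₁ Z)),
        AgreeOn (Bj ν.M₁ Z k) (avgFamily (Node00.avOfRecord F 2 Kt) U) (avgFamily (Node00.avOfRecord F 2 Kt) (qsstarGIter0 k (ext Vk))) →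
        wilsonAction4 U ≤ wilsonAction4 U₀ →
          ∃ u : GaugeTransf (F.P Kt) 0 SU2, (∀ j, j ≤ k → ∀ b ∈ bondsOf (Bj ν.M₁ Z k j), toMS u j b.src = toMS u j b.tgt ∧ ∀ g : SU2, toMS u j b.src * g = g * toMS u j b.src) ∧ gaugeAct u U = U₀)) →
    ∃ R : ℝ, 0 < R ∧ ∀ Vk ∈ K,
      ∃ Ũ : VecField (F.P Kt) k (EuclideanSpace ℂ (Fin 3)) × VecField (F.P Kt) k (EuclideanSpace ℂ (Fin 3)) → PBond (F.P Kt) 0 → Matrix (Fin 2) (Fin 2) ℂ,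
        (∀ b i j, DifferentiableOn ℂ (fun z => Ũ z b i j) (ball 0 R)) ∧
        (∀ z ∈ ball (0 : VecField (F.P Kt) k (EuclideanSpace ℂ (Fin 3)) × VecField (F.P Kt) k (EuclideanSpace ℂ (Fin 3))) R, ∀ b i j, ‖Ũ z b i j‖ ≤ 𝓐₀) ∧
        ∀ p B' : VecField (F.P Kt) k E3, ‖p‖ < R → ‖B'‖ < R → ∃ U' : GaugeField (F.P Kt) 0 SU2,
          (∀ b, Ũ (cplxVec p, cplxVec B') b = ((U' b : SU2) : Matrix (Fin 2) (Fin 2) ℂ)) ∧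
            IsMinimizer (Node00.avOfRecord F 2 Kt) (Node00.regMSCoPOfRecord F 2 {ν with εreg := εr} Kt k (maxDomT ν.M₁ Z)) (Bj ν.M₁ Z k)
              (avgFamily (Node00.avOfRecord F 2 Kt) (qsstarGIter0 k (expMul su2Chart B' (ext (expMul su2Chart p Vk))))) U' := by
  have hk : k ≤ (F.P Kt).m + (F.P Kt).K := Nat.le_of_succ_le hkK
  have hM4 : 4 * (F.P Kt).L ≤ ν.M₁ := le_trans (Nat.mul_le_mul_right _ (by omega)) hfloor
  have hM : 1 ≤ ν.M₁ := le_trans (Nat.succ_le_of_lt (Nat.mul_pos (Nat.succ_pos _) (F.P Kt).L_pos)) hfloor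
  have hd2 : 2 ≤ (F.P Kt).d := le_trans (by norm_num) hd3
  -- ONE forest with its axial slice (dag-n12-w3), BEFORE the threshold
  obtain ⟨path, S, hF1, hF2, hTREE, hF3, -⟩ := exists_forest_slice_Bj (P := F.P Kt) (M₁ := ν.M₁) (Z := Z) hk hk1 hM hdiv
  obtain ⟨δ₀, hδ₀, h⟩ := hMin_atRecord_of_node00Letters_thm1AtBase_central_ofClass_threshold_uniform ν Kt hd2 Z (Bj ν.M₁ Z k) rfl hkK hM4 hdiv hZblk hsbU hρ hk1 hHB hB0 path S hF1 hF2 hTREE hF3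
  refine ⟨δ₀, hδ₀, ?_⟩
  intro Λ lo hi δ hδ hδρ ext hext K hK 𝓐₀ h𝓐₀ εr hεr hερ hεH hα3 hα2 δc hδc0 hδcδ hbase
  -- the class facts (dag-n12-w1 g4) at the tolerance `εr`
  obtain ⟨hreg', hcl, hDreg'⟩ :=
    classLetters_closure_regMSCoPOfRecord_Bj (F := F) (N := 2) (K := Kt) {ν with εreg := εr} hεr hk hdiv hfloor Z k (Nat.le_succ k) hα3 hα2
  exact h Λ lo hi hδ hδρ ext hext hK h𝓐₀ εr hεr.le hερ hεH (closure (Node00.regMSCoPOfRecord F 2 {ν with εreg := εr} Kt k (maxDomT ν.M₁ Z))) hreg' hcl hDreg' hδc0 hδcδ hbase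


/-! ## §2  The same with the gauge row asked of a RESIDUAL re-gauging `U₀^σ` — over U2 §3, the (σ)_N producer's output shape -/

/-- ★★★ **THE SAME IN RESIDUAL-GAUGE FORM (U2 §3)**: per base field the consumer supplies the minimiser `U₀` for the class at `εr`, the datum's regularity, a RESIDUAL gauge `σ` (scale-`j`
images `1` at both ends of every constrained bond of `𝐁_k(Z)`), the (δ) row for `U₀^σ`, and (T1@q₀) for `U₀`; forest and class facts discharged as in §1.
[cite: Balaban1985Variational, Thm 1 p.279, (3)–(4) p.278, (181) p.307; Balaban1985RegularSpaces, (1.7) p.77; Balaban1989LargeFieldI, (1.74) p.192, Prop. 1 p.194; Balaban1989LargeFieldII, p.357, (1.12)–(1.13) p.359; Balaban1988Convergent, (2.10)–(2.13) pp.256–257; Balaban1987RG1, (0.4) p.253] -/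
theorem hMin_atRecord_Bj_of_printLetters_ofClassThresholdUniform_residual (ν : Node00.Stage7Numerics) (Kt : ℕ) (hd3 : 3 ≤ (F.P Kt).d) (Z : Set (Site (F.P Kt) 0))
    (hkK : k + 1 ≤ (F.P Kt).m + (F.P Kt).K) (hk1 : 1 ≤ k) (hdiv : side (F.P Kt).L ν.M₁ k ∣ (F.P Kt).sitesPerDir 0) (hfloor : ((F.P Kt).d + 14) * (F.P Kt).L ≤ ν.M₁) (hZblk : IsBlockUnion k Z)
    -- the per-HEIGHT letters (EXISTENCE constants per (instance, height), inhabited before everything else by dag-n12-w6's `N12HsurjOfClass.exists_hsurjLetters`): the radius letter `hsbU` at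
    -- `ρ″ > 0` and the right-inverse letter `hHB` at `(εH, B)`, `0 ≤ B` — `ν.εreg` is NOT read (the class tolerance `εr` comes after the threshold)
    {ρ'' : ℝ} (hsbU : ∀ W : GaugeField (F.P Kt) 0 SU2, ‖coeField W - 1‖ ≤ ρ'' → SmallBelow (Node00.avOfRecord F 2 Kt) k W) (hρ : 0 < ρ'')
    {εH B : ℝ}
    (hHB : ∀ (Wd : MSField (F.P Kt) SU2) (U₀ : GaugeField (F.P Kt) 0 SU2),
      AgreeOn (Bj ν.M₁ Z k) (avgFamily (avOfRecord F 2 Kt) U₀) Wd →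
      (∀ i' : Fin (constrCard (Bj ν.M₁ Z k) k), ∃ U' : GaugeField (F.P Kt) 0 SU2,
        (∀ b ∈ feeds (((constrEnum (Bj ν.M₁ Z k) k).symm i').1 : ℕ) ((constrEnum (Bj ν.M₁ Z k) k).symm i').2.1, U' b = U₀ b) ∧
          SmallBelow (avOfRecord F 2 Kt) k U') →
      (∀ (j : ℕ), 1 ≤ j → j ≤ k → ∀ y : Site (F.P Kt) j, embIter j y ∈ maxDomT ν.M₁ Z j → ∃ U' : GaugeField (F.P Kt) 0 SU2,
        (∀ c : PBond (F.P Kt) j, (c.src = y ∨ c.tgt = y) → ∀ b₀ : PBond (F.P Kt) 0,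
          (iterBlockOf j b₀.src = c.src ∨ iterBlockOf j b₀.src = c.tgt) → (iterBlockOf j b₀.tgt = c.src ∨ iterBlockOf j b₀.tgt = c.tgt) → U' b₀ = U₀ b₀) ∧
        SmallBelow (avOfRecord F 2 Kt) k U') →
      (∀ (j : ℕ), 1 ≤ j → j ≤ k → ∀ y : Site (F.P Kt) j, embIter j y ∈ maxDomT ν.M₁ Z j →
        PlaqSmallOn (boxPlaqs (fun κ => lift (F.P Kt) (embIter j y) κ - ((((F.P Kt).L ^ j : ℕ) : ℤ) + ((((F.P Kt).L ^ j - 1) / 2 : ℕ) : ℤ)))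
          (fun κ => lift (F.P Kt) (embIter j y) κ + ((((F.P Kt).L ^ j : ℕ) : ℤ) + ((((F.P Kt).L ^ j - 1) / 2 : ℕ) : ℤ))) : Set (Plaq (F.P Kt) 0)) εH U₀) →
      ∃ H : (Fin (constrCard (Bj ν.M₁ Z k) k) → lieSU (Fin 2)) → PBond (F.P Kt) 0 → lieSU (Fin 2),
        (∀ v, fderiv ℝ (msChart F 2 Kt k (Bj ν.M₁ Z k) Wd U₀) 0 (H v) = v) ∧ ∀ v, Real.sqrt (∑ b, ‖H v b‖ ^ 2) ≤ B * ‖v‖) (hB0 : 0 ≤ B) :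
    ∃ δ₀ : ℝ, 0 < δ₀ ∧
    -- THE WINDOW, THE DATUM's REGULARITY TOLERANCE, THE EXTENSION, THE COMPACT PARAMETER SET AND THE BOUND — ALL AFTER THE CONSTANTS
    ∀ (Λ : Set (Site (F.P Kt) k)) (lo hi : Fin (F.P Kt).d → ℤ) {δ : ℝ}, 0 < δ → 6 * ((((F.P Kt).d - 1 : ℕ)) : ℝ) * (F.P Kt).L ^ k * δ ≤ ρ'' →
    ∀ (ext : GaugeField (F.P Kt) k SU2 → GaugeField (F.P Kt) k SU2), (∀ W, ext W = extend Λ (shellGauge W lo hi) W) →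
    ∀ {K : Set (GaugeField (F.P Kt) k SU2)}, IsCompact K → ∀ {𝓐₀ : ℝ}, 1 < 𝓐₀ →
    -- THE CLASS TOLERANCE, ITS FLOORS AND THE CLASS FACTS, AFTER THE THRESHOLD (εreg-uniform edition: `ν⟨εreg := εr⟩`, `M₁` unchanged)
    -- (w1 g4's class letters at the tolerance `εr`: positivity and [4] Prop. 2's smallness at `α₀ = 2L²·εr` — the inputs of `classLetters_closure_regMSCoPOfRecord_Bj`, which discharges U2's
    -- class facts `reg' hreg' hcl hDreg'` at `reg' := closure` of the class `U_k({Ω_j(Z)}, εr)`)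
    ∀ (εr : ℝ), 0 < εr → 12 * ((((F.P Kt).d - 1 : ℕ)) : ℝ) * (F.P Kt).L * εr ≤ ρ'' → εr ≤ εH →
      (143 * (((((F.P Kt).d + 4 : ℕ) : ℝ)) ^ 2 / 4) ^ 2) * (2 * ((F.P Kt).L : ℝ) ^ 2 * εr) ≤ 1 / 3 →
      2 * (2 * ((F.P Kt).L : ℝ) ^ 2 * εr) ≤ 2 * deltaSU (Fin 2) / ((((F.P Kt).d + 4) * (F.P Kt).L : ℕ) : ℝ) ^ 2 →
    ∀ {δc : ℝ}, 0 ≤ δc → δc ≤ δ₀ →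
    (∀ Vk ∈ K, ∃ (U₀ : GaugeField (F.P Kt) 0 SU2) (σ : GaugeTransf (F.P Kt) 0 SU2),
      IsMinimizer (Node00.avOfRecord F 2 Kt) (Node00.regMSCoPOfRecord F 2 {ν with εreg := εr} Kt k (maxDomT ν.M₁ Z)) (Bj ν.M₁ Z k)
        (avgFamily (Node00.avOfRecord F 2 Kt) (qsstarGIter0 k (ext Vk))) U₀ ∧
      -- the DATUM's scale-`k` plaquette regularity on `Z` (the p. 193 extension `Ṽ_k = ext V_k`; the road's `B15ShellGauge193Local.dist1_plaqHol_extend_shellGauge_le`)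
      PlaqSmallOn (plaqsInside (pts k Z)) δ (ext Vk) ∧
      -- a RESIDUAL gauge `σ` (scale-`j` images `1` at both ends of every constrained bond — dag-n12-w3's (σ)_N producer's shape) …
      (∀ j, j ≤ k → ∀ b ∈ bondsOf (Bj ν.M₁ Z k j), toMS σ j b.src = 1 ∧ toMS σ j b.tgt = 1) ∧
      -- … in which (δ) holds: `U₀^σ` bondwise `δc`-flat on the plaquettes meeting a bond sourced in `Ω₁(Z)`; the tower-flatness row (δ_T) and the multiplier row (M) of p717767 FOLLOW (`B15Prop1TowerFlatOfNearFlat`; dag-n12-w6's `…N12MultiplierLetterOfClass` + the lane's `…N12SliceDatumCurvatureOfClass`)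
      (∀ q : Plaq (F.P Kt) 0, ((⟨q.src, q.μ⟩ : PBond (F.P Kt) 0) ∈ {b : PBond (F.P Kt) 0 | b.src ∈ maxDomT ν.M₁ Z 1} ∨
          (⟨q.src.shift q.μ, q.ν⟩ : PBond (F.P Kt) 0) ∈ {b : PBond (F.P Kt) 0 | b.src ∈ maxDomT ν.M₁ Z 1} ∨
          (⟨q.src.shift q.ν, q.μ⟩ : PBond (F.P Kt) 0) ∈ {b : PBond (F.P Kt) 0 | b.src ∈ maxDomT ν.M₁ Z 1} ∨
          (⟨q.src, q.ν⟩ : PBond (F.P Kt) 0) ∈ {b : PBond (F.P Kt) 0 | b.src ∈ maxDomT ν.M₁ Z 1}) →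
        ‖((gaugeAct σ U₀ ⟨q.src, q.μ⟩ : SU2) : Matrix (Fin 2) (Fin 2) ℂ) - 1‖ ≤ δc ∧ ‖((gaugeAct σ U₀ ⟨q.src.shift q.μ, q.ν⟩ : SU2) : Matrix (Fin 2) (Fin 2) ℂ) - 1‖ ≤ δc ∧
          ‖((gaugeAct σ U₀ ⟨q.src.shift q.ν, q.μ⟩ : SU2) : Matrix (Fin 2) (Fin 2) ℂ) - 1‖ ≤ δc ∧ ‖((gaugeAct σ U₀ ⟨q.src, q.ν⟩ : SU2) : Matrix (Fin 2) (Fin 2) ℂ) - 1‖ ≤ δc) ∧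
      -- (T1@q₀) — the capstone's row verbatim
      (∀ U ∈ closure (Node00.regMSCoPOfRecord F 2 {ν with εreg := εr} Kt k (maxDomT ν.M₁ Z)),
        AgreeOn (Bj ν.M₁ Z k) (avgFamily (Node00.avOfRecord F 2 Kt) U) (avgFamily (Node00.avOfRecord F 2 Kt) (qsstarGIter0 k (ext Vk))) →
        wilsonAction4 U ≤ wilsonAction4 U₀ →
          ∃ u : GaugeTransf (F.P Kt) 0 SU2, (∀ j, j ≤ k → ∀ b ∈ bondsOf (Bj ν.M₁ Z k j), toMS u j b.src = toMS u j b.tgt ∧ ∀ g : SU2, toMS u j b.src * g = g * toMS u j b.src) ∧ gaugeAct u U = U₀)) →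
    ∃ R : ℝ, 0 < R ∧ ∀ Vk ∈ K,
      ∃ Ũ : VecField (F.P Kt) k (EuclideanSpace ℂ (Fin 3)) × VecField (F.P Kt) k (EuclideanSpace ℂ (Fin 3)) → PBond (F.P Kt) 0 → Matrix (Fin 2) (Fin 2) ℂ,
        (∀ b i j, DifferentiableOn ℂ (fun z => Ũ z b i j) (ball 0 R)) ∧
        (∀ z ∈ ball (0 : VecField (F.P Kt) k (EuclideanSpace ℂ (Fin 3)) × VecField (F.P Kt) k (EuclideanSpace ℂ (Fin 3))) R, ∀ b i j, ‖Ũ z b i j‖ ≤ 𝓐₀) ∧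
        ∀ p B' : VecField (F.P Kt) k E3, ‖p‖ < R → ‖B'‖ < R → ∃ U' : GaugeField (F.P Kt) 0 SU2,
          (∀ b, Ũ (cplxVec p, cplxVec B') b = ((U' b : SU2) : Matrix (Fin 2) (Fin 2) ℂ)) ∧
            IsMinimizer (Node00.avOfRecord F 2 Kt) (Node00.regMSCoPOfRecord F 2 {ν with εreg := εr} Kt k (maxDomT ν.M₁ Z)) (Bj ν.M₁ Z k)
              (avgFamily (Node00.avOfRecord F 2 Kt) (qsstarGIter0 k (expMul su2Chart B' (ext (expMul su2Chart p Vk))))) U' := by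
  have hk : k ≤ (F.P Kt).m + (F.P Kt).K := Nat.le_of_succ_le hkK
  have hM4 : 4 * (F.P Kt).L ≤ ν.M₁ := le_trans (Nat.mul_le_mul_right _ (by omega)) hfloor
  have hM : 1 ≤ ν.M₁ := le_trans (Nat.succ_le_of_lt (Nat.mul_pos (Nat.succ_pos _) (F.P Kt).L_pos)) hfloor
  have hd2 : 2 ≤ (F.P Kt).d := le_trans (by norm_num) hd3
  -- ONE forest with its axial slice (dag-n12-w3), BEFORE the threshold
  obtain ⟨path, S, hF1, hF2, hTREE, hF3, -⟩ := exists_forest_slice_Bj (P := F.P Kt) (M₁ := ν.M₁) (Z := Z) hk hk1 hM hdiv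
  obtain ⟨δ₀, hδ₀, h⟩ := hMin_atRecord_of_node00Letters_thm1AtBase_central_ofClass_threshold_residual_uniform ν Kt hd2 Z (Bj ν.M₁ Z k) rfl hkK hM4 hdiv hZblk hsbU hρ hk1 hHB hB0 path S hF1 hF2 hTREE hF3
  refine ⟨δ₀, hδ₀, ?_⟩
  intro Λ lo hi δ hδ hδρ ext hext K hK 𝓐₀ h𝓐₀ εr hεr hερ hεH hα3 hα2 δc hδc0 hδcδ hbase
  -- the class facts (dag-n12-w1 g4) at the tolerance `εr`
  obtain ⟨hreg', hcl, hDreg'⟩ :=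
    classLetters_closure_regMSCoPOfRecord_Bj (F := F) (N := 2) (K := Kt) {ν with εreg := εr} hεr hk hdiv hfloor Z k (Nat.le_succ k) hα3 hα2
  exact h Λ lo hi hδ hδρ ext hext hK h𝓐₀ εr hεr.le hερ hεH (closure (Node00.regMSCoPOfRecord F 2 {ν with εreg := εr} Kt k (maxDomT ν.M₁ Z))) hreg' hcl hDreg' hδc0 hδcδ hbase


/-! ## §3  §1 on the (compact) CLOSED small-field guard — the shape the knit-row junction consumes -/

/-- ★★★ **§1 ON THE CLOSED GUARD `{∀ p ∈ G, |V_k(∂p) − 1| ≤ eR}` (any `G`, any `eR`, quantified after `δ₀` in `K`'s place)**: the guard is itself compact (`isCompact_setOf_plaqLeOn`), so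
§1 at `K :=` the guard gives ONE radius `R` for every guarded base field — the shape `N12MinimiserFamilyKnitRowThresholdUniform` §1 consumes at `G := plaqsInside (pts k (Z ∩ Λᶜ))`.
[cite: Balaban1989LargeFieldI, (1.74) p.192, Prop. 1 p.194 (last clause); Balaban1985Variational, Thm 1 p.279, (7) p.278, Prop. 9 (190) p.309; Balaban1988Convergent, (2.12)–(2.13) pp.256–257] -/
theorem hMin_closedGuard_atRecord_Bj_of_printLetters_ofClassThresholdUniform (ν : Node00.Stage7Numerics) (Kt : ℕ) (hd3 : 3 ≤ (F.P Kt).d) (Z : Set (Site (F.P Kt) 0))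
    (hkK : k + 1 ≤ (F.P Kt).m + (F.P Kt).K) (hk1 : 1 ≤ k) (hdiv : side (F.P Kt).L ν.M₁ k ∣ (F.P Kt).sitesPerDir 0) (hfloor : ((F.P Kt).d + 14) * (F.P Kt).L ≤ ν.M₁) (hZblk : IsBlockUnion k Z)
    -- the per-HEIGHT letters (EXISTENCE constants per (instance, height), inhabited before everything else by dag-n12-w6's `N12HsurjOfClass.exists_hsurjLetters`): the radius letter `hsbU` at
    -- `ρ″ > 0` and the right-inverse letter `hHB` at `(εH, B)`, `0 ≤ B` — `ν.εreg` is NOT read (the class tolerance `εr` comes after the threshold)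
    {ρ'' : ℝ} (hsbU : ∀ W : GaugeField (F.P Kt) 0 SU2, ‖coeField W - 1‖ ≤ ρ'' → SmallBelow (Node00.avOfRecord F 2 Kt) k W) (hρ : 0 < ρ'')
    {εH B : ℝ}
    (hHB : ∀ (Wd : MSField (F.P Kt) SU2) (U₀ : GaugeField (F.P Kt) 0 SU2),
      AgreeOn (Bj ν.M₁ Z k) (avgFamily (avOfRecord F 2 Kt) U₀) Wd →
      (∀ i' : Fin (constrCard (Bj ν.M₁ Z k) k), ∃ U' : GaugeField (F.P Kt) 0 SU2,
        (∀ b ∈ feeds (((constrEnum (Bj ν.M₁ Z k) k).symm i').1 : ℕ) ((constrEnum (Bj ν.M₁ Z k) k).symm i').2.1, U' b = U₀ b) ∧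
          SmallBelow (avOfRecord F 2 Kt) k U') →
      (∀ (j : ℕ), 1 ≤ j → j ≤ k → ∀ y : Site (F.P Kt) j, embIter j y ∈ maxDomT ν.M₁ Z j → ∃ U' : GaugeField (F.P Kt) 0 SU2,
        (∀ c : PBond (F.P Kt) j, (c.src = y ∨ c.tgt = y) → ∀ b₀ : PBond (F.P Kt) 0,
          (iterBlockOf j b₀.src = c.src ∨ iterBlockOf j b₀.src = c.tgt) → (iterBlockOf j b₀.tgt = c.src ∨ iterBlockOf j b₀.tgt = c.tgt) → U' b₀ = U₀ b₀) ∧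
        SmallBelow (avOfRecord F 2 Kt) k U') →
      (∀ (j : ℕ), 1 ≤ j → j ≤ k → ∀ y : Site (F.P Kt) j, embIter j y ∈ maxDomT ν.M₁ Z j →
        PlaqSmallOn (boxPlaqs (fun κ => lift (F.P Kt) (embIter j y) κ - ((((F.P Kt).L ^ j : ℕ) : ℤ) + ((((F.P Kt).L ^ j - 1) / 2 : ℕ) : ℤ)))
          (fun κ => lift (F.P Kt) (embIter j y) κ + ((((F.P Kt).L ^ j : ℕ) : ℤ) + ((((F.P Kt).L ^ j - 1) / 2 : ℕ) : ℤ))) : Set (Plaq (F.P Kt) 0)) εH U₀) →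
      ∃ H : (Fin (constrCard (Bj ν.M₁ Z k) k) → lieSU (Fin 2)) → PBond (F.P Kt) 0 → lieSU (Fin 2),
        (∀ v, fderiv ℝ (msChart F 2 Kt k (Bj ν.M₁ Z k) Wd U₀) 0 (H v) = v) ∧ ∀ v, Real.sqrt (∑ b, ‖H v b‖ ^ 2) ≤ B * ‖v‖) (hB0 : 0 ≤ B) :
    ∃ δ₀ : ℝ, 0 < δ₀ ∧
    -- THE WINDOW, THE DATUM's REGULARITY TOLERANCE, THE EXTENSION, THE COMPACT PARAMETER SET AND THE BOUND — ALL AFTER THE CONSTANTS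
    ∀ (Λ : Set (Site (F.P Kt) k)) (lo hi : Fin (F.P Kt).d → ℤ) {δ : ℝ}, 0 < δ → 6 * ((((F.P Kt).d - 1 : ℕ)) : ℝ) * (F.P Kt).L ^ k * δ ≤ ρ'' →
    ∀ (ext : GaugeField (F.P Kt) k SU2 → GaugeField (F.P Kt) k SU2), (∀ W, ext W = extend Λ (shellGauge W lo hi) W) →
    ∀ (G : Set (Plaq (F.P Kt) k)) (eR : ℝ) {𝓐₀ : ℝ}, 1 < 𝓐₀ →
    -- THE CLASS TOLERANCE, ITS FLOORS AND THE CLASS FACTS, AFTER THE THRESHOLD (εreg-uniform edition: `ν⟨εreg := εr⟩`, `M₁` unchanged)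
    -- (w1 g4's class letters at the tolerance `εr`: positivity and [4] Prop. 2's smallness at `α₀ = 2L²·εr` — the inputs of `classLetters_closure_regMSCoPOfRecord_Bj`, which discharges U2's
    -- class facts `reg' hreg' hcl hDreg'` at `reg' := closure` of the class `U_k({Ω_j(Z)}, εr)`)
    ∀ (εr : ℝ), 0 < εr → 12 * ((((F.P Kt).d - 1 : ℕ)) : ℝ) * (F.P Kt).L * εr ≤ ρ'' → εr ≤ εH →
      (143 * (((((F.P Kt).d + 4 : ℕ) : ℝ)) ^ 2 / 4) ^ 2) * (2 * ((F.P Kt).L : ℝ) ^ 2 * εr) ≤ 1 / 3 →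
      2 * (2 * ((F.P Kt).L : ℝ) ^ 2 * εr) ≤ 2 * deltaSU (Fin 2) / ((((F.P Kt).d + 4) * (F.P Kt).L : ℕ) : ℝ) ^ 2 →
    ∀ {δc : ℝ}, 0 ≤ δc → δc ≤ δ₀ →
    (∀ Vk : GaugeField (F.P Kt) k SU2, (∀ p ∈ G, dist1 (GaugeField.plaqHol Vk p) ≤ eR) → ∃ U₀ : GaugeField (F.P Kt) 0 SU2,
      IsMinimizer (Node00.avOfRecord F 2 Kt) (Node00.regMSCoPOfRecord F 2 {ν with εreg := εr} Kt k (maxDomT ν.M₁ Z)) (Bj ν.M₁ Z k)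
        (avgFamily (Node00.avOfRecord F 2 Kt) (qsstarGIter0 k (ext Vk))) U₀ ∧
      -- the DATUM's scale-`k` plaquette regularity on `Z` (the p. 193 extension `Ṽ_k = ext V_k`; the road's `B15ShellGauge193Local.dist1_plaqHol_extend_shellGauge_le`)
      PlaqSmallOn (plaqsInside (pts k Z)) δ (ext Vk) ∧
      -- (δ) DISPLAYED — THE ONE GAUGE letter (the direct road's (N)-package clause): `U₀` bondwise `δc`-flat on the plaquettes meeting a bond sourced in `Ω₁(Z)`; the tower-flatness row (δ_T) and the multiplier row (M) of p717767 FOLLOW (`B15Prop1TowerFlatOfNearFlat`; dag-n12-w6's `…N12MultiplierLetterOfClass` + the lane's `…N12SliceDatumCurvatureOfClass`)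
      (∀ q : Plaq (F.P Kt) 0, ((⟨q.src, q.μ⟩ : PBond (F.P Kt) 0) ∈ {b : PBond (F.P Kt) 0 | b.src ∈ maxDomT ν.M₁ Z 1} ∨
          (⟨q.src.shift q.μ, q.ν⟩ : PBond (F.P Kt) 0) ∈ {b : PBond (F.P Kt) 0 | b.src ∈ maxDomT ν.M₁ Z 1} ∨
          (⟨q.src.shift q.ν, q.μ⟩ : PBond (F.P Kt) 0) ∈ {b : PBond (F.P Kt) 0 | b.src ∈ maxDomT ν.M₁ Z 1} ∨
          (⟨q.src, q.ν⟩ : PBond (F.P Kt) 0) ∈ {b : PBond (F.P Kt) 0 | b.src ∈ maxDomT ν.M₁ Z 1}) →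
        ‖((U₀ ⟨q.src, q.μ⟩ : SU2) : Matrix (Fin 2) (Fin 2) ℂ) - 1‖ ≤ δc ∧ ‖((U₀ ⟨q.src.shift q.μ, q.ν⟩ : SU2) : Matrix (Fin 2) (Fin 2) ℂ) - 1‖ ≤ δc ∧
          ‖((U₀ ⟨q.src.shift q.ν, q.μ⟩ : SU2) : Matrix (Fin 2) (Fin 2) ℂ) - 1‖ ≤ δc ∧ ‖((U₀ ⟨q.src, q.ν⟩ : SU2) : Matrix (Fin 2) (Fin 2) ℂ) - 1‖ ≤ δc) ∧
      -- (T1@q₀) — the capstone's row verbatim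
      (∀ U ∈ closure (Node00.regMSCoPOfRecord F 2 {ν with εreg := εr} Kt k (maxDomT ν.M₁ Z)),
        AgreeOn (Bj ν.M₁ Z k) (avgFamily (Node00.avOfRecord F 2 Kt) U) (avgFamily (Node00.avOfRecord F 2 Kt) (qsstarGIter0 k (ext Vk))) →
        wilsonAction4 U ≤ wilsonAction4 U₀ →
          ∃ u : GaugeTransf (F.P Kt) 0 SU2, (∀ j, j ≤ k → ∀ b ∈ bondsOf (Bj ν.M₁ Z k j), toMS u j b.src = toMS u j b.tgt ∧ ∀ g : SU2, toMS u j b.src * g = g * toMS u j b.src) ∧ gaugeAct u U = U₀)) →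
    ∃ R : ℝ, 0 < R ∧ ∀ Vk : GaugeField (F.P Kt) k SU2, (∀ p ∈ G, dist1 (GaugeField.plaqHol Vk p) ≤ eR) →
      ∃ Ũ : VecField (F.P Kt) k (EuclideanSpace ℂ (Fin 3)) × VecField (F.P Kt) k (EuclideanSpace ℂ (Fin 3)) → PBond (F.P Kt) 0 → Matrix (Fin 2) (Fin 2) ℂ,
        (∀ b i j, DifferentiableOn ℂ (fun z => Ũ z b i j) (ball 0 R)) ∧
        (∀ z ∈ ball (0 : VecField (F.P Kt) k (EuclideanSpace ℂ (Fin 3)) × VecField (F.P Kt) k (EuclideanSpace ℂ (Fin 3))) R, ∀ b i j, ‖Ũ z b i j‖ ≤ 𝓐₀) ∧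
        ∀ p B' : VecField (F.P Kt) k E3, ‖p‖ < R → ‖B'‖ < R → ∃ U' : GaugeField (F.P Kt) 0 SU2,
          (∀ b, Ũ (cplxVec p, cplxVec B') b = ((U' b : SU2) : Matrix (Fin 2) (Fin 2) ℂ)) ∧
            IsMinimizer (Node00.avOfRecord F 2 Kt) (Node00.regMSCoPOfRecord F 2 {ν with εreg := εr} Kt k (maxDomT ν.M₁ Z)) (Bj ν.M₁ Z k)
              (avgFamily (Node00.avOfRecord F 2 Kt) (qsstarGIter0 k (expMul su2Chart B' (ext (expMul su2Chart p Vk))))) U' := by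
  obtain ⟨δ₀, hδ₀, h⟩ := hMin_atRecord_Bj_of_printLetters_ofClassThresholdUniform ν Kt hd3 Z hkK hk1 hdiv hfloor hZblk hsbU hρ hHB hB0
  refine ⟨δ₀, hδ₀, ?_⟩
  intro Λ lo hi δ hδ hδρ ext hext G eR 𝓐₀ h𝓐₀ εr hεr hερ hεH hα3 hα2 δc hδc0 hδcδ hletters
  exact h Λ lo hi hδ hδρ ext hext (isCompact_setOf_plaqLeOn G eR) h𝓐₀ εr hεr hερ hεH hα3 hα2 hδc0 hδcδ hletters


/-! ## §4  §2 on the (compact) CLOSED small-field guard — residual-gauge form, the road of record -/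

/-- ★★★ **§2 ON THE CLOSED GUARD** (residual-gauge form): as §3 over §2 — ONE radius `R` for every base field of the closed guard `{∀ p ∈ G, |V_k(∂p) − 1| ≤ eR}`, the per-base-field
rows being (E), the datum's regularity, (σ residual, (δ) for `U₀^σ`), (T1@q₀); the shape `N12MinimiserFamilyKnitRowThresholdUniform` §2 consumes.
[cite: Balaban1989LargeFieldI, (1.74) p.192, Prop. 1 p.194 (last clause); Balaban1985Variational, Thm 1 p.279, (3)–(4) p.278, (181) p.307; Balaban1988Convergent, (2.12)–(2.13) pp.256–257] -/
theorem hMin_closedGuard_atRecord_Bj_of_printLetters_ofClassThresholdUniform_residual (ν : Node00.Stage7Numerics) (Kt : ℕ) (hd3 : 3 ≤ (F.P Kt).d) (Z : Set (Site (F.P Kt) 0))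
    (hkK : k + 1 ≤ (F.P Kt).m + (F.P Kt).K) (hk1 : 1 ≤ k) (hdiv : side (F.P Kt).L ν.M₁ k ∣ (F.P Kt).sitesPerDir 0) (hfloor : ((F.P Kt).d + 14) * (F.P Kt).L ≤ ν.M₁) (hZblk : IsBlockUnion k Z)
    -- the per-HEIGHT letters (EXISTENCE constants per (instance, height), inhabited before everything else by dag-n12-w6's `N12HsurjOfClass.exists_hsurjLetters`): the radius letter `hsbU` at
    -- `ρ″ > 0` and the right-inverse letter `hHB` at `(εH, B)`, `0 ≤ B` — `ν.εreg` is NOT read (the class tolerance `εr` comes after the threshold)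
    {ρ'' : ℝ} (hsbU : ∀ W : GaugeField (F.P Kt) 0 SU2, ‖coeField W - 1‖ ≤ ρ'' → SmallBelow (Node00.avOfRecord F 2 Kt) k W) (hρ : 0 < ρ'')
    {εH B : ℝ}
    (hHB : ∀ (Wd : MSField (F.P Kt) SU2) (U₀ : GaugeField (F.P Kt) 0 SU2),
      AgreeOn (Bj ν.M₁ Z k) (avgFamily (avOfRecord F 2 Kt) U₀) Wd →
      (∀ i' : Fin (constrCard (Bj ν.M₁ Z k) k), ∃ U' : GaugeField (F.P Kt) 0 SU2,
        (∀ b ∈ feeds (((constrEnum (Bj ν.M₁ Z k) k).symm i').1 : ℕ) ((constrEnum (Bj ν.M₁ Z k) k).symm i').2.1, U' b = U₀ b) ∧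
          SmallBelow (avOfRecord F 2 Kt) k U') →
      (∀ (j : ℕ), 1 ≤ j → j ≤ k → ∀ y : Site (F.P Kt) j, embIter j y ∈ maxDomT ν.M₁ Z j → ∃ U' : GaugeField (F.P Kt) 0 SU2,
        (∀ c : PBond (F.P Kt) j, (c.src = y ∨ c.tgt = y) → ∀ b₀ : PBond (F.P Kt) 0,
          (iterBlockOf j b₀.src = c.src ∨ iterBlockOf j b₀.src = c.tgt) → (iterBlockOf j b₀.tgt = c.src ∨ iterBlockOf j b₀.tgt = c.tgt) → U' b₀ = U₀ b₀) ∧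
        SmallBelow (avOfRecord F 2 Kt) k U') →
      (∀ (j : ℕ), 1 ≤ j → j ≤ k → ∀ y : Site (F.P Kt) j, embIter j y ∈ maxDomT ν.M₁ Z j →
        PlaqSmallOn (boxPlaqs (fun κ => lift (F.P Kt) (embIter j y) κ - ((((F.P Kt).L ^ j : ℕ) : ℤ) + ((((F.P Kt).L ^ j - 1) / 2 : ℕ) : ℤ)))
          (fun κ => lift (F.P Kt) (embIter j y) κ + ((((F.P Kt).L ^ j : ℕ) : ℤ) + ((((F.P Kt).L ^ j - 1) / 2 : ℕ) : ℤ))) : Set (Plaq (F.P Kt) 0)) εH U₀) →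
      ∃ H : (Fin (constrCard (Bj ν.M₁ Z k) k) → lieSU (Fin 2)) → PBond (F.P Kt) 0 → lieSU (Fin 2),
        (∀ v, fderiv ℝ (msChart F 2 Kt k (Bj ν.M₁ Z k) Wd U₀) 0 (H v) = v) ∧ ∀ v, Real.sqrt (∑ b, ‖H v b‖ ^ 2) ≤ B * ‖v‖) (hB0 : 0 ≤ B) :
    ∃ δ₀ : ℝ, 0 < δ₀ ∧
    -- THE WINDOW, THE DATUM's REGULARITY TOLERANCE, THE EXTENSION, THE COMPACT PARAMETER SET AND THE BOUND — ALL AFTER THE CONSTANTS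
    ∀ (Λ : Set (Site (F.P Kt) k)) (lo hi : Fin (F.P Kt).d → ℤ) {δ : ℝ}, 0 < δ → 6 * ((((F.P Kt).d - 1 : ℕ)) : ℝ) * (F.P Kt).L ^ k * δ ≤ ρ'' →
    ∀ (ext : GaugeField (F.P Kt) k SU2 → GaugeField (F.P Kt) k SU2), (∀ W, ext W = extend Λ (shellGauge W lo hi) W) →
    ∀ (G : Set (Plaq (F.P Kt) k)) (eR : ℝ) {𝓐₀ : ℝ}, 1 < 𝓐₀ →
    -- THE CLASS TOLERANCE, ITS FLOORS AND THE CLASS FACTS, AFTER THE THRESHOLD (εreg-uniform edition: `ν⟨εreg := εr⟩`, `M₁` unchanged)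
    -- (w1 g4's class letters at the tolerance `εr`: positivity and [4] Prop. 2's smallness at `α₀ = 2L²·εr` — the inputs of `classLetters_closure_regMSCoPOfRecord_Bj`, which discharges U2's
    -- class facts `reg' hreg' hcl hDreg'` at `reg' := closure` of the class `U_k({Ω_j(Z)}, εr)`)
    ∀ (εr : ℝ), 0 < εr → 12 * ((((F.P Kt).d - 1 : ℕ)) : ℝ) * (F.P Kt).L * εr ≤ ρ'' → εr ≤ εH →
      (143 * (((((F.P Kt).d + 4 : ℕ) : ℝ)) ^ 2 / 4) ^ 2) * (2 * ((F.P Kt).L : ℝ) ^ 2 * εr) ≤ 1 / 3 →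
      2 * (2 * ((F.P Kt).L : ℝ) ^ 2 * εr) ≤ 2 * deltaSU (Fin 2) / ((((F.P Kt).d + 4) * (F.P Kt).L : ℕ) : ℝ) ^ 2 →
    ∀ {δc : ℝ}, 0 ≤ δc → δc ≤ δ₀ →
    (∀ Vk : GaugeField (F.P Kt) k SU2, (∀ p ∈ G, dist1 (GaugeField.plaqHol Vk p) ≤ eR) → ∃ (U₀ : GaugeField (F.P Kt) 0 SU2) (σ : GaugeTransf (F.P Kt) 0 SU2),
      IsMinimizer (Node00.avOfRecord F 2 Kt) (Node00.regMSCoPOfRecord F 2 {ν with εreg := εr} Kt k (maxDomT ν.M₁ Z)) (Bj ν.M₁ Z k)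
        (avgFamily (Node00.avOfRecord F 2 Kt) (qsstarGIter0 k (ext Vk))) U₀ ∧
      -- the DATUM's scale-`k` plaquette regularity on `Z` (the p. 193 extension `Ṽ_k = ext V_k`; the road's `B15ShellGauge193Local.dist1_plaqHol_extend_shellGauge_le`)
      PlaqSmallOn (plaqsInside (pts k Z)) δ (ext Vk) ∧
      -- a RESIDUAL gauge `σ` (scale-`j` images `1` at both ends of every constrained bond — dag-n12-w3's (σ)_N producer's shape) …
      (∀ j, j ≤ k → ∀ b ∈ bondsOf (Bj ν.M₁ Z k j), toMS σ j b.src = 1 ∧ toMS σ j b.tgt = 1) ∧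
      -- … in which (δ) holds: `U₀^σ` bondwise `δc`-flat on the plaquettes meeting a bond sourced in `Ω₁(Z)`; the tower-flatness row (δ_T) and the multiplier row (M) of p717767 FOLLOW (`B15Prop1TowerFlatOfNearFlat`; dag-n12-w6's `…N12MultiplierLetterOfClass` + the lane's `…N12SliceDatumCurvatureOfClass`)
      (∀ q : Plaq (F.P Kt) 0, ((⟨q.src, q.μ⟩ : PBond (F.P Kt) 0) ∈ {b : PBond (F.P Kt) 0 | b.src ∈ maxDomT ν.M₁ Z 1} ∨
          (⟨q.src.shift q.μ, q.ν⟩ : PBond (F.P Kt) 0) ∈ {b : PBond (F.P Kt) 0 | b.src ∈ maxDomT ν.M₁ Z 1} ∨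
          (⟨q.src.shift q.ν, q.μ⟩ : PBond (F.P Kt) 0) ∈ {b : PBond (F.P Kt) 0 | b.src ∈ maxDomT ν.M₁ Z 1} ∨
          (⟨q.src, q.ν⟩ : PBond (F.P Kt) 0) ∈ {b : PBond (F.P Kt) 0 | b.src ∈ maxDomT ν.M₁ Z 1}) →
        ‖((gaugeAct σ U₀ ⟨q.src, q.μ⟩ : SU2) : Matrix (Fin 2) (Fin 2) ℂ) - 1‖ ≤ δc ∧ ‖((gaugeAct σ U₀ ⟨q.src.shift q.μ, q.ν⟩ : SU2) : Matrix (Fin 2) (Fin 2) ℂ) - 1‖ ≤ δc ∧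
          ‖((gaugeAct σ U₀ ⟨q.src.shift q.ν, q.μ⟩ : SU2) : Matrix (Fin 2) (Fin 2) ℂ) - 1‖ ≤ δc ∧ ‖((gaugeAct σ U₀ ⟨q.src, q.ν⟩ : SU2) : Matrix (Fin 2) (Fin 2) ℂ) - 1‖ ≤ δc) ∧
      -- (T1@q₀) — the capstone's row verbatim
      (∀ U ∈ closure (Node00.regMSCoPOfRecord F 2 {ν with εreg := εr} Kt k (maxDomT ν.M₁ Z)),
        AgreeOn (Bj ν.M₁ Z k) (avgFamily (Node00.avOfRecord F 2 Kt) U) (avgFamily (Node00.avOfRecord F 2 Kt) (qsstarGIter0 k (ext Vk))) →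
        wilsonAction4 U ≤ wilsonAction4 U₀ →
          ∃ u : GaugeTransf (F.P Kt) 0 SU2, (∀ j, j ≤ k → ∀ b ∈ bondsOf (Bj ν.M₁ Z k j), toMS u j b.src = toMS u j b.tgt ∧ ∀ g : SU2, toMS u j b.src * g = g * toMS u j b.src) ∧ gaugeAct u U = U₀)) →
    ∃ R : ℝ, 0 < R ∧ ∀ Vk : GaugeField (F.P Kt) k SU2, (∀ p ∈ G, dist1 (GaugeField.plaqHol Vk p) ≤ eR) →
      ∃ Ũ : VecField (F.P Kt) k (EuclideanSpace ℂ (Fin 3)) × VecField (F.P Kt) k (EuclideanSpace ℂ (Fin 3)) → PBond (F.P Kt) 0 → Matrix (Fin 2) (Fin 2) ℂ,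
        (∀ b i j, DifferentiableOn ℂ (fun z => Ũ z b i j) (ball 0 R)) ∧
        (∀ z ∈ ball (0 : VecField (F.P Kt) k (EuclideanSpace ℂ (Fin 3)) × VecField (F.P Kt) k (EuclideanSpace ℂ (Fin 3))) R, ∀ b i j, ‖Ũ z b i j‖ ≤ 𝓐₀) ∧
        ∀ p B' : VecField (F.P Kt) k E3, ‖p‖ < R → ‖B'‖ < R → ∃ U' : GaugeField (F.P Kt) 0 SU2,
          (∀ b, Ũ (cplxVec p, cplxVec B') b = ((U' b : SU2) : Matrix (Fin 2) (Fin 2) ℂ)) ∧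
            IsMinimizer (Node00.avOfRecord F 2 Kt) (Node00.regMSCoPOfRecord F 2 {ν with εreg := εr} Kt k (maxDomT ν.M₁ Z)) (Bj ν.M₁ Z k)
              (avgFamily (Node00.avOfRecord F 2 Kt) (qsstarGIter0 k (expMul su2Chart B' (ext (expMul su2Chart p Vk))))) U' := by
  obtain ⟨δ₀, hδ₀, h⟩ := hMin_atRecord_Bj_of_printLetters_ofClassThresholdUniform_residual ν Kt hd3 Z hkK hk1 hdiv hfloor hZblk hsbU hρ hHB hB0
  refine ⟨δ₀, hδ₀, ?_⟩
  intro Λ lo hi δ hδ hδρ ext hext G eR 𝓐₀ h𝓐₀ εr hεr hερ hεH hα3 hα2 δc hδc0 hδcδ hletters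
  exact h Λ lo hi hδ hδρ ext hext (isCompact_setOf_plaqLeOn G eR) h𝓐₀ εr hεr hερ hεH hα3 hα2 hδc0 hδcδ hletters

end Summit.QuantumFields.YangMills.BalabanUVNodes.N12MinimiserFamilyAtRecordBjTowerThresholdUniform

end
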